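import Mathlib
import HarnessLib

/-!
# Helical (screw) functions and Kreĭn's representation / extension theorem

A continuous function `g` with `g(-t) = conj (g t)` is **helical** on `[-a, a]` (class `𝒢ₐ`, scalar
case `p = 1` of Arov–Dym 2012 §9.1) when the kernel
`k(t, s) = g(t - s) - g(t) - g(-s) + g(0)` is positive semidefinite on `[0, a] × [0, a]`.
Kreĭn's theorem (Arov–Dym 2012 Thm 9.1, after Gohberg–Goldberg 1997 Thm 3.12 and Kreĭn 1944):
`g ∈ 𝒢ₐ` iff on `[-a, a]`
`g(t) = -β + i t α + (1/π) ∫ (e^{-iμt} - 1 + iμt/(1+μ²)) dσ(μ)/μ²` with `α, β ∈ ℝ` and a positive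
measure `σ` on `ℝ` with `∫ dσ(μ)/(1+μ²) < ∞`; consequently Kreĭn's helical extension problem
(extend `g ∈ 𝒢ₐ` to `𝒢_∞`) is always solvable (`helicalExtension_exists`, proved from the fact).

We also record the Kreĭn–Langer / Suzuki normalisation `IsScrewFunctionOn a g` ("screw functions":
`g` on `(-2a, 2a)`, kernel non-negative definite for `|tᵢ| < a`, Suzuki 2023 §1), which is the form in
which route PluckedString (RiemannHypothesis) meets these objects (`g = -Ψ`).

## Design
* Positivity of the Hermitian kernel is expressed with `open scoped ComplexOrder`
  (`0 ≤ w ↔ 0 ≤ w.re ∧ w.im = 0`), over all finite configurations.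
* The integrand of Kreĭn's formula is extended by continuity (`-t²/2`) at `μ = 0`, where `σ` may have
  an atom (`kreinHelicalIntegrand`); with this convention the printed formula is meaningful as a
  Bochner integral (the integrand is `O(μ⁻²)` at infinity and bounded near `0`).
* One named fact: `KreinHelicalRepresentation`. Not here: the matrix case `p > 1`, Theorem 9.3
  (correspondence with the Carathéodory class), accelerants (Arov–Dym 2012 §9.3).

## References
ArovDym2012 (§9.1, Thm 9.1), Suzuki2023 (§1).
-/

open MeasureTheory Set Complex
open scoped ComplexOrder ComplexConjugate ENNReal

noncomputable section

namespace Literature.Analysis.InverseSpectral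

/-- The kernel `k_g(t, s) = g(t - s) - g(t) - g(-s) + g(0)` attached to `g : ℝ → ℂ`.
[cite: ArovDym2012, §9.1 (9.2)] -/
def helicalKernel (g : ℝ → ℂ) (t s : ℝ) : ℂ := g (t - s) - g t - g (-s) + g 0

/-- Unfolding of `helicalKernel`. [folklore] -/
lemma helicalKernel_apply (g : ℝ → ℂ) (t s : ℝ) :
    helicalKernel g t s = g (t - s) - g t - g (-s) + g 0 := rfl

/-- The kernel vanishes on the axes: `k_g(t, 0) = 0`. [folklore] -/
@[simp] lemma helicalKernel_right_zero (g : ℝ → ℂ) (t : ℝ) : helicalKernel g t 0 = 0 := by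
  simp [helicalKernel]

/-- `g` is a **helical function on `[-a, a]`** (`g ∈ 𝒢ₐ`, scalar case, `0 < a < ∞`): `g` is continuous on
`[-a, a]`, `g(-t) = conj (g t)` there, and the kernel `k_g(t,s) = g(t-s) - g(t) - g(-s) + g(0)` is
positive (semidefinite) on `[0, a] × [0, a]`: `∑ᵢⱼ conj ξᵢ k_g(tᵢ, tⱼ) ξⱼ ≥ 0` for all finite
configurations `tᵢ ∈ [0, a]`, `ξᵢ ∈ ℂ`. [cite: ArovDym2012, §9.1] -/
def IsHelicalOn (a : ℝ) (g : ℝ → ℂ) : Prop :=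
  ContinuousOn g (Set.Icc (-a) a) ∧ (∀ t ∈ Set.Icc (-a) a, g (-t) = conj (g t)) ∧
    ∀ (n : ℕ) (t : Fin n → ℝ) (ξ : Fin n → ℂ), (∀ i, t i ∈ Set.Icc 0 a) →
      0 ≤ ∑ i, ∑ j, conj (ξ i) * helicalKernel g (t i) (t j) * ξ j

/-- `g` is a **helical function on `ℝ`** (`g ∈ 𝒢_∞`): continuous, `g(-t) = conj (g t)`, and the kernel
`k_g` is positive (semidefinite) on `[0, ∞) × [0, ∞)`. [cite: ArovDym2012, §9.1] -/
def IsHelical (g : ℝ → ℂ) : Prop :=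
  Continuous g ∧ (∀ t, g (-t) = conj (g t)) ∧
    ∀ (n : ℕ) (t : Fin n → ℝ) (ξ : Fin n → ℂ), (∀ i, 0 ≤ t i) →
      0 ≤ ∑ i, ∑ j, conj (ξ i) * helicalKernel g (t i) (t j) * ξ j

/-- A helical function on `ℝ` is helical on every window. [folklore] -/
lemma IsHelical.isHelicalOn {g : ℝ → ℂ} (hg : IsHelical g) (a : ℝ) : IsHelicalOn a g :=
  ⟨hg.1.continuousOn, fun t _ => hg.2.1 t, fun n t ξ ht => hg.2.2 n t ξ fun i => (ht i).1⟩

/-- **Screw functions** in the Kreĭn–Langer / Suzuki normalisation, `0 < a ≤ ∞`: `g` is continuous on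
`(-2a, 2a)`, Hermitian (`g(-t) = conj (g t)`) there, and the kernel
`G_g(t, u) = g(t - u) - g(t) - g(-u) + g(0)` is non-negative definite on `(-a, a)`:
`∑ᵢⱼ G_g(tᵢ, tⱼ) ξᵢ conj ξⱼ ≥ 0` for all finite configurations `|tᵢ| < a`.
[cite: Suzuki2023, §1 (1.4)–(1.5)] -/
def IsScrewFunctionOn (a : ℝ≥0∞) (g : ℝ → ℂ) : Prop :=
  ContinuousOn g {t : ℝ | ENNReal.ofReal |t| < 2 * a} ∧
    (∀ t : ℝ, ENNReal.ofReal |t| < 2 * a → g (-t) = conj (g t)) ∧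
    ∀ (n : ℕ) (t : Fin n → ℝ) (ξ : Fin n → ℂ), (∀ i, ENNReal.ofReal |t i| < a) →
      0 ≤ ∑ i, ∑ j, helicalKernel g (t i) (t j) * ξ i * conj (ξ j)

/-- The integrand `(e^{-iμt} - 1 + iμt/(1+μ²))/μ²` of Kreĭn's formula, extended by continuity to its
limit `-t²/2` at `μ = 0` (so that an atom of `σ` at `0` contributes `-σ{0} t²/(2π)`).
[cite: ArovDym2012, Thm 9.1 (9.4)] -/
def kreinHelicalIntegrand (t μ : ℝ) : ℂ :=
  if μ = 0 then -((t : ℂ) ^ 2 / 2)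
  else (Complex.exp (-(I * μ * t)) - 1 + I * μ * t / (1 + (μ : ℂ) ^ 2)) / (μ : ℂ) ^ 2

/-- Value of the integrand at `μ = 0`. [folklore] -/
@[simp] lemma kreinHelicalIntegrand_zero (t : ℝ) : kreinHelicalIntegrand t 0 = -((t : ℂ) ^ 2 / 2) := by
  simp [kreinHelicalIntegrand]

/-- Kreĭn's formula `g(t) = -β + i t α + (1/π) ∫ (e^{-iμt} - 1 + iμt/(1+μ²)) dσ(μ)/μ²` as a function
of the data `(α, β, σ)`. [cite: ArovDym2012, Thm 9.1 (9.4)] -/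
def kreinHelicalRep (α β : ℝ) (σ : Measure ℝ) (t : ℝ) : ℂ :=
  -(β : ℂ) + I * t * α + (1 / Real.pi : ℂ) * ∫ μ, kreinHelicalIntegrand t μ ∂σ

/-- The growth condition `∫ dσ(μ)/(1 + μ²) < ∞` on the measure in Kreĭn's formula.
[cite: ArovDym2012, Thm 9.1 (9.5)] -/
def IsKreinHelicalMeasure (σ : Measure ℝ) : Prop :=
  (∫⁻ μ, ENNReal.ofReal ((1 + μ ^ 2)⁻¹) ∂σ) < ⊤

/-- **Kreĭn's representation theorem for helical functions** (named fact, scalar case `p = 1`):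
(i) for `0 < a < ∞`, `g ∈ 𝒢ₐ` if and only if `g(t) = -β + i t α + (1/π) ∫ (e^{-iμt} - 1 + iμt/(1+μ²))
dσ(μ)/μ²` on `[-a, a]` for some `α, β ∈ ℝ` and a positive Borel measure `σ` on `ℝ` with
`∫ dσ(μ)/(1+μ²) < ∞`; (ii) the same with `[-a, a]`, `𝒢ₐ` replaced by `ℝ`, `𝒢_∞`. In particular the
helical extension problem `HEP(g; a)` is always solvable (`helicalExtension_exists`). A proof for
`p = 1`, after Kreĭn's lecture notes, is in Gohberg–Goldberg 1997, Thm 3.12.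
[cite: ArovDym2012, Thm 9.1] -/
def KreinHelicalRepresentation : Prop :=
  (∀ a : ℝ, 0 < a → ∀ g : ℝ → ℂ,
      IsHelicalOn a g ↔ ∃ (α β : ℝ) (σ : Measure ℝ), IsKreinHelicalMeasure σ ∧
        ∀ t ∈ Set.Icc (-a) a, g t = kreinHelicalRep α β σ t) ∧
    ∀ g : ℝ → ℂ,
      IsHelical g ↔ ∃ (α β : ℝ) (σ : Measure ℝ), IsKreinHelicalMeasure σ ∧
        ∀ t, g t = kreinHelicalRep α β σ t

/-- **Kreĭn's helical extension problem is always solvable**: every `g ∈ 𝒢ₐ` is the restriction to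
`[-a, a]` of some `G ∈ 𝒢_∞` (take Kreĭn's formula with the same data on all of `ℝ`). Proved from the
named fact `KreinHelicalRepresentation`. [cite: ArovDym2012, §9.1 (after Thm 9.1)] -/
theorem helicalExtension_exists (h : KreinHelicalRepresentation) {a : ℝ} (ha : 0 < a) {g : ℝ → ℂ}
    (hg : IsHelicalOn a g) : ∃ G : ℝ → ℂ, IsHelical G ∧ Set.EqOn G g (Set.Icc (-a) a) := by
  obtain ⟨α, β, σ, hσ, hrep⟩ := (h.1 a ha g).mp hg
  exact ⟨kreinHelicalRep α β σ, (h.2 _).mpr ⟨α, β, σ, hσ, fun _ => rfl⟩,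
    fun t ht => (hrep t ht).symm⟩

/-- All solutions of the extension problem given by Kreĭn's formula: any data `(α, β, σ)` representing
`g` on `[-a, a]` define an extension in `𝒢_∞`. [folklore] -/
theorem isHelical_kreinHelicalRep (h : KreinHelicalRepresentation) {α β : ℝ} {σ : Measure ℝ}
    (hσ : IsKreinHelicalMeasure σ) : IsHelical (kreinHelicalRep α β σ) :=
  (h.2 _).mpr ⟨α, β, σ, hσ, fun _ => rfl⟩

end Literature.Analysis.InverseSpectral

end
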